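import Summits.HodgeConjecture.CorCM.IrreducibleOddWeightsCoreTowerPointwiseConj
import Summits.HodgeConjecture.CorCM.IrreducibleOddWeightsCoreTowerCanonical
import HarnessLib

/-!
# Core tower, XI: the LEVEL-THREE criterion implies pointwise partial conjugation (PC)

COR-CM (cell `pub-hodgecm2`, binder seat `b16` gen 67, count-neutral claim CORE TOWER, file A11; theorems only, no
definition, no named fact, no `sorry`).  NEW as stated, hence under `Summits/`.  HONEST FRAMING: Galois theory of two CM
fields inside `ℂ` and its consequences for `Hg(A₀ × A₁) = Hg(A₀) × Hg(A₁)`; the only Hodge classes claimed algebraic are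
those of the tree's nondegenerate-family theorem (Pohlmann–Gordon); `HC_CM` is neither used nor asserted.

SETTING (A2, A9).  CM fields `K_{i₀}, K_{i₁}`, `L₀ = normalClosure ℚ K_{i₀} ℂ`, `a₀ : K_{i₀} → ℂ`; number fields `T₁, T₂` with
`b(K_{i₁}) ∩ L₀ ⊆ L_{T₁}` for all `b` and `a(K_{i₀}) ∩ L_{T₁} ⊆ L_{T₂}` for all `a` (canonically the Galois closures `E₁ ⊇ E₂` of
the nested trace fields, A8).  THE LEVEL-THREE CRITERION (A2): `b(K_{i₁}) ∩ L_{T₂} ⊂ ℝ` for every `b` ⟹ additivity for all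
types.  A9 showed: the level-TWO criterion implies gen 48's (PC).  Here:

* **`pointwiseConj_of_traces_le_of_traces_le_of_forall_conj_apply_eq`: THE LEVEL-THREE CRITERION IMPLIES (PC)** — for
  every `y : K_{i₁} → ℂ` some `σ ∈ Aut(ℂ)` has `σ ∘ y = ȳ` and `σ ∘ a₀ = a₀`.  In `Aut(ℂ)`: `conj = β·ν₂` with `β` fixing
  `y(K_{i₁})`, `ν₂` fixing `L_{T₂}` (Galois correspondence, `Aut(ℂ/L_{T₂})` normal); `ν₂ = ν₁·α` with `ν₁` fixing `L_{T₁}`,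
  `α` fixing `a₀(K_{i₀})`; `ν₁` fixes `y(K_{i₁}) ∩ L₀`, so acts on the embeddings of `K_{i₀}` like some `β′` fixing
  `y(K_{i₁})` (A9); then `σ = β′⁻¹ν₂` works.  (Group-theoretically: `c ∈ A·B·A` with `c` central forces `c ∈ A·B`.)
* canonical form `pointwiseConj_level_three`; consequences through gen 48 (`B• = D•` + HC on all products of nondegenerate
  realisations, `hodgeConjectureFor_prod_pair_level_three_real`); and for a NORMAL level-three trace field
  `pointwiseConj_iff_level_three_of_normal_trace`: (PC) ⟺ conjugation fixes every `b(K_{i₁}) ∩ E₂` ⟺ additivity ∀ types.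

## References

* [Lang2002] S. Lang, *Algebra*, 3rd ed., VI §1 Thm. 1.1, Cor. 1.6, Thm. 1.12, Thm. 1.14 and V §2 Thm. 2.8.
* [Gordon1999HodgeAVSurvey] B. B. Gordon, *A survey of the Hodge conjecture for abelian varieties*, §3 Theorem (proof),
  7.5–7.7, 10.10.
* [Shimura1998] G. Shimura, *Abelian Varieties with Complex Multiplication and Modular Functions*, §8.3, §18.1, §18.2.
-/

set_option autoImplicit false

noncomputable section

open scoped BigOperators Classical
open CategoryTheory CategoryTheory.Limits NumberField Module IntermediateField

namespace Summit.HodgeConjecture.CorCM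

open Literature.NumberTheory.ComplexMultiplication Literature.AlgebraicGeometry.Pohlmann1968
open Literature.NumberTheory.NumberFields (mem_closure_fixing_union_of_apply_eq)
open Literature.AlgebraicGeometry.Motives (AbelianVariety CMType)
open Literature.AlgebraicGeometry.Motives.AbelianVariety
open Literature.AlgebraicGeometry.HodgeTheory
open Literature.AlgebraicGeometry.ComplexMultiplication (IsCMTypeRealisation)
open Literature.AlgebraicGeometry.VanGeemen1994 (hodgeClassSpan)
open Literature.Barriers.HodgeConjecture (divisorClassesSpan)

section PC

variable {I : Type} {K : I → Type} [∀ i, Field (K i)] [∀ i, NumberField (K i)] [∀ i, IsCMField (K i)]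
  {T : Type} [Field T] [NumberField T] {T' : Type} [Field T'] [NumberField T']

/-- **THE LEVEL-THREE CRITERION IMPLIES POINTWISE PARTIAL CONJUGATION.**  `b(K_{i₁}) ∩ L₀ ⊆ L_{T₁}` (all `b`),
`a(K_{i₀}) ∩ L_{T₁} ⊆ L_{T₂}` (all `a`), and conjugation fixes `b(K_{i₁}) ∩ L_{T₂}` pointwise (all `b`) ⟹ for every
`y : K_{i₁} → ℂ` some `σ ∈ Aut(ℂ)` satisfies `σ ∘ y = ȳ` and `σ ∘ a₀ = a₀`.
[cite: Lang2002, VI §1 Thm. 1.1, Cor. 1.6, Thm. 1.14 and V §2 Thm. 2.8] [cite: Shimura1998, §18.1 and §18.2] -/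
theorem pointwiseConj_of_traces_le_of_traces_le_of_forall_conj_apply_eq {i₀ i₁ : I} (a₀ : K i₀ →+* ℂ)
    (hT₁ : ∀ (b : K i₁ →+* ℂ) (k : K i₁), b k ∈ normalClosure ℚ (K i₀) ℂ → b k ∈ normalClosure ℚ T ℂ)
    (hT₂ : ∀ (a : K i₀ →+* ℂ) (k : K i₀), a k ∈ normalClosure ℚ T ℂ → a k ∈ normalClosure ℚ T' ℂ)
    (hreal : ∀ (b : K i₁ →+* ℂ) (k : K i₁), b k ∈ normalClosure ℚ T' ℂ → starRingEnd ℂ (b k) = b k)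
    (y : K i₁ →+* ℂ) :
    ∃ σ : ℂ ≃+* ℂ, σ • y = (starRingAut : ℂ ≃+* ℂ) • y ∧ σ • a₀ = a₀ := by
  haveI : FiniteDimensional ℚ (y.toRatAlgHom).fieldRange :=
    LinearEquiv.finiteDimensional (AlgEquiv.ofInjectiveField y.toRatAlgHom).toLinearEquiv
  haveI : FiniteDimensional ℚ (a₀.toRatAlgHom).fieldRange :=
    LinearEquiv.finiteDimensional (AlgEquiv.ofInjectiveField a₀.toRatAlgHom).toLinearEquiv
  -- (1) `conj = β ν₂`, `β` fixing `y(K_{i₁})`, `ν₂` fixing `L_{T₂}`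
  have hfix : ∀ z : ℂ, z ∈ y.toRatAlgHom.fieldRange → z ∈ normalClosure ℚ T' ℂ →
      (starRingAut : ℂ ≃+* ℂ) z = z := by
    intro z hz hzT
    obtain ⟨k, rfl⟩ := AlgHom.mem_fieldRange.1 hz
    rw [starRingAut_apply, ← starRingEnd_apply]
    exact hreal y k hzT
  obtain ⟨β, ν₂, hβ, hν₂, hconj⟩ :=
    exists_mul_of_mem_closure_of_normalClosure (T := T') y (mem_closure_fixing_union_of_apply_eq hfix)
  -- (2) `ν₂⁻¹ = α' ν₁'` with `α'` fixing `a₀(K_{i₀})`, `ν₁'` fixing `L_{T₁}`; hence `ν₂ = ν₁ α`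
  have hν₂fix : ∀ z : ℂ, z ∈ a₀.toRatAlgHom.fieldRange → z ∈ normalClosure ℚ T ℂ → ν₂⁻¹ z = z := by
    intro z hz hzT
    obtain ⟨k, rfl⟩ := AlgHom.mem_fieldRange.1 hz
    rw [RingAut.inv_apply, RingEquiv.symm_apply_eq]
    exact (hν₂ _ (hT₂ a₀ k hzT)).symm
  obtain ⟨α', ν₁', hα', hν₁', hdec⟩ :=
    exists_mul_of_mem_closure_of_normalClosure (T := T) a₀ (mem_closure_fixing_union_of_apply_eq hν₂fix)
  -- so `ν₂ = ν₁'⁻¹ α'⁻¹`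
  have hν₂eq : ν₂ = ν₁'⁻¹ * α'⁻¹ := by
    rw [← mul_inv_rev, ← hdec, inv_inv]
  -- (3) `ν₁'⁻¹` fixes `L_{T₁} ⊇ y(K_{i₁}) ∩ L₀`, hence acts on `Hom(K_{i₀}, ℂ)` like some `β'` fixing `y(K_{i₁})`
  have hν₁fix : ∀ z : ℂ, z ∈ y.toRatAlgHom.fieldRange → z ∈ normalClosure ℚ (K i₀) ℂ → ν₁'⁻¹ z = z := by
    intro z hz hz₀
    obtain ⟨k, rfl⟩ := AlgHom.mem_fieldRange.1 hz
    rw [RingAut.inv_apply, RingEquiv.symm_apply_eq]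
    exact (hν₁' _ (hT₁ y k hz₀)).symm
  obtain ⟨β', hβ', hβ'x⟩ := exists_fix_forall_smul_eq_of_mem_closure (i₀ := i₀) y
    (mem_closure_fixing_union_of_apply_eq hν₁fix)
  -- (4) `σ = β'⁻¹ ν₂`: `σ • a₀ = β'⁻¹ • ν₁'⁻¹ • α'⁻¹ • a₀ = β'⁻¹ • β' • a₀ = a₀`, `σ • y = β'⁻¹ • β⁻¹ • ȳ = ȳ`
  refine ⟨β'⁻¹ * ν₂, ?_, ?_⟩
  · have e : ν₂ = β⁻¹ * (starRingAut : ℂ ≃+* ℂ) := by rw [hconj, inv_mul_cancel_left]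
    rw [mul_smul, e, mul_smul]
    refine RingHom.ext fun k => ?_
    rw [ringEquiv_smul_apply, ringEquiv_smul_apply, ringEquiv_smul_apply, starRingAut_apply, ← starRingEnd_apply,
      ← IsCMField.complexEmbedding_complexConj, RingAut.inv_apply, RingEquiv.symm_apply_eq, RingAut.inv_apply,
      RingEquiv.symm_apply_eq]
    have h1 : β' (y ((IsCMField.complexConj (K i₁)) k)) = y ((IsCMField.complexConj (K i₁)) k) := hβ' _ ⟨_, rfl⟩
    have h2 : β (y ((IsCMField.complexConj (K i₁)) k)) = y ((IsCMField.complexConj (K i₁)) k) := hβ _ ⟨_, rfl⟩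
    rw [h1, h2]
  · rw [mul_smul, hν₂eq, mul_smul]
    have hαa : α'⁻¹ • a₀ = a₀ := by
      refine RingHom.ext fun k => ?_
      rw [ringEquiv_smul_apply, RingAut.inv_apply, RingEquiv.symm_apply_eq]
      exact (hα' _ ⟨k, rfl⟩).symm
    rw [hαa, hβ'x a₀, inv_smul_smul]

/-- **Canonical form (the nested trace fields of A8)**: if conjugation fixes `b(K_{i₁}) ∩ E₂` pointwise for every `b`, then
(PC) holds at the base point `a₀`. [cite: Lang2002, VI §1 Thm. 1.1, Cor. 1.6 and Thm. 1.12] -/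
theorem pointwiseConj_level_three {i₀ i₁ : I} (a₀ : K i₀ →+* ℂ) (b₀ : K i₁ →+* ℂ)
    (hreal : ∀ (b : K i₁ →+* ℂ) (k : K i₁),
      b k ∈ normalClosure ℚ ↥((normalClosure ℚ ↥((normalClosure ℚ (K i₀) ℂ).comap b₀.toRatAlgHom) ℂ).comap
        a₀.toRatAlgHom) ℂ → starRingEnd ℂ (b k) = b k)
    (y : K i₁ →+* ℂ) :
    ∃ σ : ℂ ≃+* ℂ, σ • y = (starRingAut : ℂ ≃+* ℂ) • y ∧ σ • a₀ = a₀ :=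
  pointwiseConj_of_traces_le_of_traces_le_of_forall_conj_apply_eq a₀
    (T := ↥((normalClosure ℚ (K i₀) ℂ).comap b₀.toRatAlgHom))
    (T' := ↥((normalClosure ℚ ↥((normalClosure ℚ (K i₀) ℂ).comap b₀.toRatAlgHom) ℂ).comap a₀.toRatAlgHom))
    (fun b k hk => apply_mem_normalClosure_comap_of_mem (T := K i₀) b₀ b k hk)
    (fun a k hk => apply_mem_normalClosure_comap_of_mem
      (T := ↥((normalClosure ℚ (K i₀) ℂ).comap b₀.toRatAlgHom)) a₀ a k hk) hreal y

variable [Fintype I] [DecidableEq I] {Φ : ∀ i, CMType (K i)} {A : I → AbelianVariety ℂ}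
  {ι : ∀ i, 𝓞 (K i) →+* End (A i)} {θ : ∀ i, K i →+* Module.End ℂ (complexBetti (A i).X 1)}

/-- **`B• = D•` AND HC ON ALL PRODUCTS under the level-three criterion, for nondegenerate types** (through gen 48's (PC)
theorem with the slots in the order `(i₁, i₀)`). [cite: Gordon1999HodgeAVSurvey, 10.10 and 7.5–7.7] -/
theorem hodgeConjectureFor_prod_pair_level_three_real {i₀ i₁ : I} (h01 : i₀ ≠ i₁) (hI : ∀ j, j = i₀ ∨ j = i₁)
    (a₀ : K i₀ →+* ℂ) (b₀ : K i₁ →+* ℂ)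
    (hreal : ∀ (b : K i₁ →+* ℂ) (k : K i₁),
      b k ∈ normalClosure ℚ ↥((normalClosure ℚ ↥((normalClosure ℚ (K i₀) ℂ).comap b₀.toRatAlgHom) ℂ).comap
        a₀.toRatAlgHom) ℂ → starRingEnd ℂ (b k) = b k)
    (hΦ : ∀ i, IsNondegenerate (Φ i)) (hA : ∀ i, IsCMTypeRealisation (Φ i) (A i) (ι i) (θ i)) {N : ℕ}
    (π : Fin N → I) :
    HodgeConjectureFor (⨁ fun j : Fin N => A (π j)).dim (⨁ fun j : Fin N => A (π j)).X ∧
      ∀ m : ℕ, hodgeClassSpan (⨁ fun j : Fin N => A (π j)).dim (⨁ fun j : Fin N => A (π j)).X m =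
        divisorClassesSpan (⨁ fun j : Fin N => A (π j)).X (⨁ fun j : Fin N => A (π j)).dim m :=
  hodgeConjectureFor_prod_pair_of_pointwiseConj h01.symm (fun j => (hI j).symm) a₀
    (pointwiseConj_level_three a₀ b₀ hreal) hΦ hA π

end PC

section Normal

variable {I : Type} [Fintype I] {K : I → Type} [∀ i, Field (K i)] [∀ i, NumberField (K i)] [∀ i, IsCMField (K i)]

/-- **NORMAL LEVEL-THREE TRACE FIELD: (PC) at `a₀` ⟺ conjugation fixes every `b(K_{i₁}) ∩ E₂` ⟺ additivity for all CM
types** (`⟹`: gen 48 + A8's exactness; `⟸`: above). [cite: Lang2002, VI §1 Thm. 1.1, Cor. 1.6 and Thm. 1.14]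
[cite: Gordon1999HodgeAVSurvey, §3 Theorem (proof) and 7.5–7.7] -/
theorem pointwiseConj_iff_level_three_of_normal_trace {i₀ i₁ : I} (h01 : i₀ ≠ i₁) (hI : ∀ l, l = i₀ ∨ l = i₁)
    (a₀ : K i₀ →+* ℂ) (b₀ : K i₁ →+* ℂ)
    (hn : Normal ℚ ↥((normalClosure ℚ ↥((normalClosure ℚ (K i₀) ℂ).comap b₀.toRatAlgHom) ℂ).comap a₀.toRatAlgHom)) :
    (∀ y : K i₁ →+* ℂ, ∃ σ : ℂ ≃+* ℂ, σ • y = (starRingAut : ℂ ≃+* ℂ) • y ∧ σ • a₀ = a₀) ↔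
      ∀ (b : K i₁ →+* ℂ) (k : K i₁),
        b k ∈ normalClosure ℚ ↥((normalClosure ℚ ↥((normalClosure ℚ (K i₀) ℂ).comap b₀.toRatAlgHom) ℂ).comap
          a₀.toRatAlgHom) ℂ → starRingEnd ℂ (b k) = b k := by
  constructor
  · intro hpt
    exact (forall_cmFamilyRank_add_card_eq_iff_level_three_of_normal_trace h01 hI a₀ b₀ hn).1 fun Φ =>
      cmFamilyRank_add_card_eq_pair_of_pointwiseConj h01.symm (fun j => (hI j).symm) Φ a₀ hpt
  · intro hreal y
    exact pointwiseConj_level_three a₀ b₀ hreal y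

end Normal

end Summit.HodgeConjecture.CorCM

end
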